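import Summits.QuantumAdvantage.AdviceFreeQNC0.ProductBound
import Summits.QuantumAdvantage.AdviceFreeQNC0.CrossTeamEmbedding
import HarnessLib

/-!
# Cell qa-qnc0 — the product game: atoms of a column-low-degree map, small row blocks, restriction

Infrastructure for the UNCONDITIONAL rung of planner qa-qnc0-p1's line `product` of the route
crux `RingToElim` (TARGET §17.3 "Theorem U"; file `ProductHardSqrtLog.lean` assembles it):

* `prod_mem_lowDeg_mul`, `atom_mem_lowDeg` — for a map `Γ : {0,1}^L → {0,1}^{{0,1}^{L'}}` whose
  columns `u ↦ Γ u v` have `𝔽₂`-degree `≤ D`, the indicator of an ATOM `{u : Γ u = z}` has degree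
  `≤ 2^{L'}·D` (product of the `2^{L'}` column indicators);
* `ldma_of_pldams_atoms` — hence proportional residue non-avoidance (PLDAMS) at degree `2^{L'}·D`
  gives the WEIGHTED statement `κ·Σ_u f(Γ u) ≤ Σ_{|u| ≡ r (3)} f(Γ u)` for EVERY weight `f` of the
  row (in particular `f = distFail D`, the hypothesis `LDMA` of `stub_product` at these lengths);
* `le_distFail_zero_of`, `agree_ge_of_ldma` — `stub_product` at FIXED lengths `(L, L')` and degree
  `D` (pointwise hypotheses; same proof as `productHard_of_ldma_of_elimHard`);
* `elimFailBits_add`, `isElimWin_restrict`, `agreeCountR_eq_sum_restrict`, `productHard_mono_right`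
  — RESTRICTION MONOTONICITY (TARGET §17.2 "ProductMonotone", row-block direction): fixing the
  last `M` row bits of an `(L, L''+M)` instance gives `2^M` valid `(L, L'')` instances (the class
  shift `c ↦ c + 2·|b|` absorbs the weight of the fixed bits), so a loss density proved at row
  length `L''` holds at every row length `≥ L''`.

All statements are hypothesis-free lemmas or carry their hypotheses pointwise; no new `def`.
-/

namespace Summit.QuantumAdvantage.AdviceFreeQNC0

open Finset Literature.Computability.MetaComplexity Literature.Computability.MetaComplexity.Smolensky

variable {L L' : ℕ}

/-! ### Atoms of a column-low-degree map -/

/-- The constant `1` has degree `≤ D` for every `D`. -/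
private theorem one_mem_lowDeg₀ {F : Type*} [Field F] {k : ℕ} (D : ℕ) :
    (1 : CubeFn F k) ∈ lowDeg F k D := by
  rw [← mono_empty]
  exact mono_mem_lowDeg (by simp)

/-- A product of functions of degree `≤ D` has degree `≤ #factors · D`. -/
theorem prod_mem_lowDeg_mul {F : Type*} [Field F] {k D : ℕ} {ι : Type*} (S : Finset ι)
    (f : ι → CubeFn F k) (hf : ∀ i ∈ S, f i ∈ lowDeg F k D) :
    (∏ i ∈ S, f i) ∈ lowDeg F k (S.card * D) := by
  classical
  induction S using Finset.induction_on with
  | empty => rw [prod_empty, card_empty, zero_mul]; exact one_mem_lowDeg₀ 0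
  | insert a S ha ih =>
    rw [prod_insert ha, card_insert_of_notMem ha, Nat.succ_mul, add_comm]
    exact mul_mem_lowDeg_add (hf a (mem_insert_self a S))
      (ih fun i hi => hf i (mem_insert_of_mem hi))

/-- The indicator of one column value `[Γ u v = β]` has the degree of the column. -/
theorem colValue_mem_lowDeg {D : ℕ} (Γ : (Fin L → Bool) → (Fin L' → Bool) → Bool)
    (hΓ : ∀ v, HasDeg (fun u => Γ u v) D) (v : Fin L' → Bool) (β : Bool) :
    (fun u : Fin L → Bool => if Γ u v = β then (1 : ZMod 2) else 0) ∈ lowDeg (ZMod 2) L D := by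
  have h := hΓ v
  unfold HasDeg at h
  cases β with
  | true => exact h
  | false =>
    have heq : (fun u : Fin L → Bool => if Γ u v = false then (1 : ZMod 2) else 0) =
        1 + fun u => if Γ u v = true then (1 : ZMod 2) else 0 := by
      funext u
      simp only [Pi.add_apply, Pi.one_apply]
      cases Γ u v <;> decide
    rw [heq]
    exact Submodule.add_mem _ (one_mem_lowDeg₀ D) h

/-- **Atoms have degree `≤ 2^{L'}·D`**: the indicator of `{u : Γ u = z}` is the product of the
`2^{L'}` column-value indicators. -/
theorem atom_mem_lowDeg {D : ℕ} (Γ : (Fin L → Bool) → (Fin L' → Bool) → Bool)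
    (hΓ : ∀ v, HasDeg (fun u => Γ u v) D) (z : (Fin L' → Bool) → Bool) :
    (fun u : Fin L → Bool => if Γ u = z then (1 : ZMod 2) else 0) ∈
      lowDeg (ZMod 2) L (2 ^ L' * D) := by
  classical
  have heq : (fun u : Fin L → Bool => if Γ u = z then (1 : ZMod 2) else 0) =
      ∏ v : Fin L' → Bool, (fun u : Fin L → Bool => if Γ u v = z v then (1 : ZMod 2) else 0) := by
    funext u
    rw [Finset.prod_apply]
    by_cases h : Γ u = z
    · rw [if_pos h]
      symm
      exact Finset.prod_eq_one fun v _ => by rw [if_pos (congrFun h v)]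
    · rw [if_neg h]
      obtain ⟨v, hv⟩ : ∃ v, Γ u v ≠ z v := not_forall.mp fun hall => h (funext hall)
      symm
      exact Finset.prod_eq_zero (Finset.mem_univ v) (by rw [if_neg hv])
  rw [heq]
  have hcard : (univ : Finset (Fin L' → Bool)).card * D = 2 ^ L' * D := by
    rw [card_univ, Fintype.card_fun, Fintype.card_bool, Fintype.card_fin]
  rw [← hcard]
  exact prod_mem_lowDeg_mul _ _ fun v _ => colValue_mem_lowDeg Γ hΓ v (z v)

/-! ### Weighted residue non-avoidance from PLDAMS on atoms -/

/-- **LDMA from PLDAMS on atoms.** If every `𝔽₂`-polynomial of degree `≤ 2^{L'}·D` on `{0,1}^L`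
has a `κ`-fraction of its support in each residue class `|u| ≡ r (mod 3)`, then for every map
`Γ` with columns of degree `≤ D` and EVERY weight `f` of the row, the class `r` carries a
`κ`-fraction of `Σ_u f(Γ u)` (each weight is constant on the atoms of `Γ`). -/
theorem ldma_of_pldams_atoms {κ : ℝ} {D : ℕ}
    (hP : ∀ g : CubeFn (ZMod 2) L, g ∈ lowDeg (ZMod 2) L (2 ^ L' * D) → ∀ r : ℕ,
      κ * ((univ.filter fun u : Fin L → Bool => g u ≠ 0).card : ℝ) ≤
        ((univ.filter fun u : Fin L → Bool => g u ≠ 0 ∧ wt u % 3 = r % 3).card : ℝ))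
    (Γ : (Fin L → Bool) → (Fin L' → Bool) → Bool) (hΓ : ∀ v, HasDeg (fun u => Γ u v) D)
    (f : ((Fin L' → Bool) → Bool) → ℕ) (r : ℕ) :
    κ * ((∑ u : Fin L → Bool, f (Γ u) : ℕ) : ℝ) ≤
      ((∑ u ∈ univ.filter (fun u : Fin L → Bool => wt u % 3 = r % 3), f (Γ u) : ℕ) : ℝ) := by
  classical
  -- fibre decomposition of both sums along `Γ`
  have hL : (∑ u : Fin L → Bool, (f (Γ u) : ℝ)) =
      ∑ z : (Fin L' → Bool) → Bool, (f z : ℝ) * ((univ.filter fun u : Fin L → Bool => Γ u = z).card : ℝ) := by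
    rw [← Finset.sum_fiberwise_of_maps_to (s := (univ : Finset (Fin L → Bool)))
      (t := (univ : Finset ((Fin L' → Bool) → Bool))) (g := Γ) (fun u _ => mem_univ _)
      (f := fun u => (f (Γ u) : ℝ))]
    refine Finset.sum_congr rfl fun z _ => ?_
    rw [Finset.sum_congr rfl fun u hu => by rw [(Finset.mem_filter.1 hu).2], Finset.sum_const,
      nsmul_eq_mul, mul_comm]
  have hR : (∑ u ∈ univ.filter (fun u : Fin L → Bool => wt u % 3 = r % 3), (f (Γ u) : ℝ)) =
      ∑ z : (Fin L' → Bool) → Bool, (f z : ℝ) *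
        (((univ.filter fun u : Fin L → Bool => wt u % 3 = r % 3).filter fun u => Γ u = z).card : ℝ) := by
    rw [← Finset.sum_fiberwise_of_maps_to (s := univ.filter fun u : Fin L → Bool => wt u % 3 = r % 3)
      (t := (univ : Finset ((Fin L' → Bool) → Bool))) (g := Γ) (fun u _ => mem_univ _)
      (f := fun u => (f (Γ u) : ℝ))]
    refine Finset.sum_congr rfl fun z _ => ?_
    rw [Finset.sum_congr rfl fun u hu => by rw [(Finset.mem_filter.1 hu).2], Finset.sum_const,
      nsmul_eq_mul, mul_comm]
  push_cast
  rw [hL, hR, Finset.mul_sum]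
  refine Finset.sum_le_sum fun z _ => ?_
  -- PLDAMS for the atom `{Γ = z}`
  have hatom := hP _ (atom_mem_lowDeg Γ hΓ z) r
  have h1 : (univ.filter fun u : Fin L → Bool => (if Γ u = z then (1 : ZMod 2) else 0) ≠ 0) =
      univ.filter fun u : Fin L → Bool => Γ u = z := by
    ext u
    simp only [mem_filter, mem_univ, true_and]
    by_cases h : Γ u = z <;> simp [h]
  have h2 : (univ.filter fun u : Fin L → Bool =>
      (if Γ u = z then (1 : ZMod 2) else 0) ≠ 0 ∧ wt u % 3 = r % 3) =
      (univ.filter fun u : Fin L → Bool => wt u % 3 = r % 3).filter fun u => Γ u = z := by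
    ext u
    simp only [mem_filter, mem_univ, true_and]
    by_cases h : Γ u = z <;> simp [h]
  rw [h1, h2] at hatom
  have hf : (0 : ℝ) ≤ f z := Nat.cast_nonneg _
  calc κ * ((f z : ℝ) * ((univ.filter fun u : Fin L → Bool => Γ u = z).card : ℝ))
      = (f z : ℝ) * (κ * ((univ.filter fun u : Fin L → Bool => Γ u = z).card : ℝ)) := by ring
    _ ≤ (f z : ℝ) * (((univ.filter fun u : Fin L → Bool => wt u % 3 = r % 3).filter
          fun u => Γ u = z).card : ℝ) := mul_le_mul_of_nonneg_left hatom hf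

/-! ### `stub_product` at fixed lengths -/

/-- Indicator bookkeeping: the decoder reads the stakes off their indicators. -/
private theorem dec2Z_indZ' {k : ℕ} (a b : (Fin k → Bool) → Bool) (u : Fin k → Bool) :
    dec2Z (indZ a u) (indZ b u) = dec2 (a u) (b u) := by
  unfold dec2Z indZ
  cases a u <;> cases b u <;> decide

/-- **The minimum fail weight, pointwise**: if every degree-`≤ D` decoder-eliminator on `ℓ` bits is
RIGHT on `≥ η·2^ℓ` inputs, then every fail pattern of degree `≤ D` has weight `≥ η·2^ℓ`. -/
theorem le_distFail_zero_of {η : ℝ} {ℓ D : ℕ}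
    (hE : ∀ a b : CubeFn (ZMod 2) ℓ, a ∈ lowDeg (ZMod 2) ℓ D → b ∈ lowDeg (ZMod 2) ℓ D →
      ∀ dec : ZMod 2 → ZMod 2 → ℕ,
        η * (2 : ℝ) ^ ℓ ≤ ((univ.filter fun u : Fin ℓ → Bool =>
          dec (a u) (b u) % 3 = Hegedus.wt u % 3).card : ℝ)) :
    η * (2 : ℝ) ^ ℓ ≤ (distFail D (fun _ : Fin ℓ → Bool => false) : ℝ) := by
  obtain ⟨F, hF, hdF⟩ := exists_distFail_eq D (fun _ : Fin ℓ → Bool => false)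
  obtain ⟨a, b, ha, hb, e⟩ := isElimFail_class0 hF
  have h := hE (indZ a) (indZ b) ha hb dec2Z
  rw [← hdF]
  refine le_trans h ?_
  unfold hdist
  exact_mod_cast card_le_card fun u hu => by
    have hu' : dec2Z (indZ a u) (indZ b u) % 3 = Hegedus.wt u % 3 := (Finset.mem_filter.1 hu).2
    rw [dec2Z_indZ'] at hu'
    refine Finset.mem_filter.2 ⟨Finset.mem_univ _, ?_⟩
    rw [e u]
    unfold elimFail
    rw [fail_of_dec2 (a u) (b u) (wt u) hu']
    exact Bool.false_ne_true

/-- **`stub_product` at fixed lengths `(L, L')` and degree `D`** (TARGET §17.1 + §17.4, the proof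
of `productHard_of_ldma_of_elimHard` with pointwise hypotheses): weighted residue non-avoidance
for the potential costs of column-degree-`D` maps (`hL`) and a minimum fail weight `≥ η·2^{L'}`
(`hw`) give `κη·2^{L+L'}` agreements (lost cells) in the `(L, L')` product game at degree `D`. -/
theorem agree_ge_of_ldma {κ η : ℝ} (hκ : 0 ≤ κ) {D : ℕ}
    (hL : ∀ Γ : (Fin L → Bool) → (Fin L' → Bool) → Bool, (∀ v, HasDeg (fun u => Γ u v) D) →
      ∀ r : ℕ, κ * ((∑ u : Fin L → Bool, distFail D (Γ u) : ℕ) : ℝ) ≤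
        ((∑ u ∈ univ.filter (fun u : Fin L → Bool => wt u % 3 = r % 3), distFail D (Γ u) : ℕ) : ℝ))
    (hw : η * (2 : ℝ) ^ L' ≤ (distFail D (fun _ : Fin L' → Bool => false) : ℝ))
    (X Y : (Fin L → Bool) → (Fin L' → Bool) → Bool)
    (hX : ∀ v, IsElimWin D (fun u => X u v)) (hY : ∀ u, IsElimWin D (fun v => Y u v)) :
    κ * η * (2 : ℝ) ^ (L + L') ≤ (agreeCountR X Y : ℝ) := by
  -- Alice's class-0 stakes, column by column
  have hXc : ∀ v, ∃ ab : ((Fin L → Bool) → Bool) × ((Fin L → Bool) → Bool),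
      HasDeg ab.1 D ∧ HasDeg ab.2 D ∧ ∀ u, X u v = !(elimFail 0 ab.1 ab.2 u) := fun v => by
    obtain ⟨a, b, ha, hb, h⟩ := isElimWin_class0 (hX v)
    exact ⟨(a, b), ha, hb, h⟩
  choose ab hab using hXc
  -- the zero-sum triple as maps `Γ r : u ↦ g_r(u, ·)`
  set Γ : Fin 3 → (Fin L → Bool) → (Fin L' → Bool) → Bool :=
    fun r u v => triple r ((ab v).1 u) ((ab v).2 u) with hΓ
  have hΓdeg : ∀ r v, HasDeg (fun u => Γ r u v) D := by
    intro r v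
    simp only [hΓ, triple]
    split_ifs
    · exact (hab v).2.1
    · exact (hab v).1
    · exact hasDeg_xor (hab v).1 (hab v).2.1
  have hXΓ : ∀ u v, X u v = Γ (resLabel u) u v := fun u v => by
    rw [(hab v).2.2 u]
    unfold elimFail
    rw [win_eq_triple]
  -- Bob's fail pattern in row `u`
  have hYf : ∀ u, IsElimFail D (fun v => !(Y u v)) := by
    intro u
    obtain ⟨c, a, b, ha, hb, h⟩ := hY u
    refine ⟨c, a, b, ha, hb, fun v => ?_⟩
    have hv : Y u v = !elimFail c a b v := h v
    show (!Y u v) = elimFail c a b v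
    rw [hv, Bool.not_not]
  -- row decomposition
  have hrow : ∀ u, distFail D (Γ (resLabel u) u) ≤ (univ.filter fun v => X u v = Y u v).card := by
    intro u
    refine le_trans (distFail_le _ (hYf u)) (le_of_eq ?_)
    unfold hdist
    congr 1
    ext v
    simp only [mem_filter, mem_univ, true_and, hXΓ u v]
    cases Γ (resLabel u) u v <;> cases Y u v <;> decide
  have hagree : agreeCountR X Y = ∑ u, (univ.filter fun v => X u v = Y u v).card := by
    unfold agreeCountR
    exact card_filter_prod_eq_sum (fun u v => X u v = Y u v)
  -- LDMA, one residue at a time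
  have hLr : ∀ r : Fin 3, κ * ∑ u : Fin L → Bool, (distFail D (Γ r u) : ℝ) ≤
      ∑ u ∈ univ.filter (fun u => resLabel u = r), (distFail D (Γ r u) : ℝ) := by
    intro r
    have h := hL (Γ r) (fun v => hΓdeg r v) ((3 - r.val) % 3)
    have hset : (univ.filter fun u : Fin L → Bool => wt u % 3 = ((3 - r.val) % 3) % 3) =
        univ.filter fun u => resLabel u = r := by
      ext u
      simp only [mem_filter, mem_univ, true_and, resLabel, Fin.ext_iff]
      have := r.isLt
      omega
    rw [hset] at h
    push_cast at h
    exact h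
  -- potential costs
  have hpc : ∀ u : Fin L → Bool, (distFail D (fun _ : Fin L' → Bool => false) : ℝ) ≤
      (distFail D (Γ 0 u) : ℝ) + distFail D (Γ 1 u) + distFail D (Γ 2 u) := fun u => by
    exact_mod_cast potential_cost D _ _ _ fun v => triple_sum ((ab v).1 u) ((ab v).2 u)
  -- assembling the chain
  have h1 : (∑ u : Fin L → Bool, (distFail D (Γ (resLabel u) u) : ℝ)) ≤ (agreeCountR X Y : ℝ) := by
    rw [hagree]
    push_cast
    exact Finset.sum_le_sum fun u _ => by exact_mod_cast hrow u
  have h2 : (∑ u : Fin L → Bool, (distFail D (Γ (resLabel u) u) : ℝ)) =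
      ∑ r : Fin 3, ∑ u ∈ univ.filter (fun u => resLabel u = r), (distFail D (Γ r u) : ℝ) := by
    rw [← Finset.sum_fiberwise_of_maps_to (s := (univ : Finset (Fin L → Bool)))
      (t := (univ : Finset (Fin 3))) (g := resLabel) (fun u _ => mem_univ _)
      (f := fun u => (distFail D (Γ (resLabel u) u) : ℝ))]
    refine Finset.sum_congr rfl fun r _ => Finset.sum_congr rfl fun u hu => ?_
    rw [(Finset.mem_filter.1 hu).2]
  have h4 : ∑ r : Fin 3, ∑ u : Fin L → Bool, (distFail D (Γ r u) : ℝ) =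
      ∑ u : Fin L → Bool, ((distFail D (Γ 0 u) : ℝ) + distFail D (Γ 1 u) + distFail D (Γ 2 u)) := by
    rw [Finset.sum_comm]
    refine Finset.sum_congr rfl fun u _ => ?_
    rw [Fin.sum_univ_three]
  have hcard : (∑ _u : Fin L → Bool, (distFail D (fun _ : Fin L' → Bool => false) : ℝ)) =
      (2 : ℝ) ^ L * (distFail D (fun _ : Fin L' → Bool => false) : ℝ) := by
    rw [Finset.sum_const, card_univ, Fintype.card_fun, Fintype.card_bool, Fintype.card_fin,
      nsmul_eq_mul]
    push_cast
    ring
  calc κ * η * (2 : ℝ) ^ (L + L')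
      = κ * ((2 : ℝ) ^ L * (η * (2 : ℝ) ^ L')) := by rw [pow_add]; ring
    _ ≤ κ * ((2 : ℝ) ^ L * (distFail D (fun _ : Fin L' → Bool => false) : ℝ)) := by
        have h2L : (0 : ℝ) ≤ (2 : ℝ) ^ L := by positivity
        exact mul_le_mul_of_nonneg_left (mul_le_mul_of_nonneg_left hw h2L) hκ
    _ = κ * ∑ _u : Fin L → Bool, (distFail D (fun _ : Fin L' → Bool => false) : ℝ) := by rw [hcard]
    _ ≤ κ * ∑ u : Fin L → Bool, ((distFail D (Γ 0 u) : ℝ) + distFail D (Γ 1 u) + distFail D (Γ 2 u)) :=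
        mul_le_mul_of_nonneg_left (Finset.sum_le_sum fun u _ => hpc u) hκ
    _ = ∑ r : Fin 3, κ * ∑ u : Fin L → Bool, (distFail D (Γ r u) : ℝ) := by
        rw [← h4, Finset.mul_sum]
    _ ≤ ∑ r : Fin 3, ∑ u ∈ univ.filter (fun u => resLabel u = r), (distFail D (Γ r u) : ℝ) :=
        Finset.sum_le_sum fun r _ => hLr r
    _ = ∑ u : Fin L → Bool, (distFail D (Γ (resLabel u) u) : ℝ) := h2.symm
    _ ≤ (agreeCountR X Y : ℝ) := h1

/-! ### Restriction monotonicity in the row-block length -/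

/-- Fixing bits of total weight `m` shifts the target class: `c ↦ c + 2m ≡ c − m (mod 3)`. -/
theorem elimFailBits_add (c : ℕ) (α β : Bool) (w m : ℕ) :
    elimFailBits c α β (w + m) = elimFailBits (c + 2 * m) α β w := by
  have h : (c % 3 + 3 - (w + m) % 3) % 3 = ((c + 2 * m) % 3 + 3 - w % 3) % 3 := by omega
  unfold elimFailBits
  rw [h]

/-- **Restricting a win pattern to a subcube is a win pattern** (of the same degree; the class
absorbs the weight of the fixed bits). -/
theorem isElimWin_restrict {L'' M D : ℕ} {h : (Fin (L'' + M) → Bool) → Bool} (hh : IsElimWin D h)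
    (b : Fin M → Bool) : IsElimWin D (fun v : Fin L'' → Bool => h (Fin.append v b)) := by
  obtain ⟨c, a, b', ha, hb, e⟩ := hh
  refine ⟨c + 2 * wt b, fun v => a (Fin.append v b), fun v => b' (Fin.append v b),
    hasDeg_append_left b ha, hasDeg_append_left b hb, fun v => ?_⟩
  show h (Fin.append v b) = _
  rw [e]
  unfold elimFail
  rw [wt_append, elimFailBits_add]

/-- **The agreements of an `(L, L''+M)` instance are the agreements of its `2^M` restrictions.** -/
theorem agreeCountR_eq_sum_restrict {L'' M : ℕ}
    (X Y : (Fin L → Bool) → (Fin (L'' + M) → Bool) → Bool) :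
    agreeCountR X Y = ∑ b : Fin M → Bool,
      agreeCountR (fun u (v : Fin L'' → Bool) => X u (Fin.append v b))
        (fun u (v : Fin L'' → Bool) => Y u (Fin.append v b)) := by
  classical
  unfold agreeCountR
  rw [card_eq_sum_card_fiberwise (f := fun p : (Fin L → Bool) × (Fin (L'' + M) → Bool) =>
    fun j : Fin M => p.2 (Fin.natAdd L'' j)) (t := (univ : Finset (Fin M → Bool)))
    (fun p _ => mem_univ _)]
  refine Finset.sum_congr rfl fun b _ => ?_
  refine Finset.card_bij' (fun p _ => (p.1, fun i => p.2 (Fin.castAdd M i)))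
    (fun q _ => (q.1, Fin.append q.2 b)) ?_ ?_ ?_ ?_
  · intro p hp
    simp only [mem_filter, mem_univ, true_and] at hp ⊢
    obtain ⟨hXY, hb⟩ := hp
    have hp2 : Fin.append (fun i => p.2 (Fin.castAdd M i)) b = p.2 := by
      rw [← hb]; exact Fin.append_castAdd_natAdd
    rw [hp2]
    exact hXY
  · intro q hq
    simp only [mem_filter, mem_univ, true_and] at hq ⊢
    refine ⟨hq, ?_⟩
    funext j
    exact Fin.append_right q.2 b j
  · intro p hp
    simp only [mem_filter, mem_univ, true_and] at hp
    obtain ⟨_, hb⟩ := hp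
    ext
    · rfl
    · simp only
      rw [← hb]
      exact congrFun Fin.append_castAdd_natAdd _
  · intro q _
    ext
    · rfl
    · simp only
      exact Fin.append_left q.2 b _

/-- **Restriction monotonicity (row-block direction).** A loss density `μ` proved for the
`(L, L'')` product game at degree `D` holds for the `(L, L''+M)` game at degree `D`: restrict. -/
theorem productHard_mono_right {μ : ℝ} {D L'' : ℕ}
    (h : ∀ X Y : (Fin L → Bool) → (Fin L'' → Bool) → Bool,
      (∀ v, IsElimWin D (fun u => X u v)) → (∀ u, IsElimWin D (fun v => Y u v)) →
        μ * (2 : ℝ) ^ (L + L'') ≤ (agreeCountR X Y : ℝ))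
    (M : ℕ) (X Y : (Fin L → Bool) → (Fin (L'' + M) → Bool) → Bool)
    (hX : ∀ v, IsElimWin D (fun u => X u v)) (hY : ∀ u, IsElimWin D (fun v => Y u v)) :
    μ * (2 : ℝ) ^ (L + (L'' + M)) ≤ (agreeCountR X Y : ℝ) := by
  rw [agreeCountR_eq_sum_restrict]
  push_cast
  have hb : ∀ b : Fin M → Bool, μ * (2 : ℝ) ^ (L + L'') ≤
      (agreeCountR (fun u (v : Fin L'' → Bool) => X u (Fin.append v b))
        (fun u (v : Fin L'' → Bool) => Y u (Fin.append v b)) : ℝ) :=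
    fun b => h _ _ (fun v => hX (Fin.append v b)) (fun u => isElimWin_restrict (hY u) b)
  calc μ * (2 : ℝ) ^ (L + (L'' + M))
      = ∑ _b : Fin M → Bool, μ * (2 : ℝ) ^ (L + L'') := by
        rw [Finset.sum_const, card_univ, Fintype.card_fun, Fintype.card_bool, Fintype.card_fin,
          nsmul_eq_mul]
        push_cast
        ring
    _ ≤ _ := Finset.sum_le_sum fun b _ => hb b

end Summit.QuantumAdvantage.AdviceFreeQNC0
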